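import Literature.MathematicalPhysics.QuantumFieldTheory.BalabanBanachStep
import HarnessLib

/-!
# Crux `BalabanStepParabolic` — forced accumulation: arrival states of long in-chart orbits are precompact

Support file for crux `stmt-QuantumFields-9684`
(`Summit.QuantumFields.YangMills.Theses.ParabolicTrajectory.BalabanStepParabolic`), line
`perfect-action-regulator-chart` (lead `prover-line-stmt-QuantumFields-9684-0`); it substantiates why the line's
load-bearing stub is crux-sized for EVERY chart, finite- or infinite-dimensional.

For ANY inhabitant `S : BalabanBanachStep G r M` (no parity, no simplicity of `G` used):

* `orbit_sync` — **two-orbit synchronisation**: two orbit segments of length `m` whose couplings stay in `[0, τ]`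
  (`τ ≤ δ`) and whose fibres stay in the chart ball `B̄_δ`, with couplings differing by at most `η` step by step,
  end at fibre distance `≤ θ'^m ‖y₀ − y₀'‖ + 3Cδ·η·m` (fading memory: `contraction` at equal coupling,
  `lipschitz_base` for the coupling offsets).
* `exists_subseq_tendsto_orbit` — **precompactness of arrival states**: if `q i` are chart points whose orbit
  segments of lengths `k i → ∞` keep couplings in `[0, τ]` and fibres in `B̄_δ`, then the arrival points
  `F^[k i] (q i)` have a convergent subsequence in `ℝ × E` — the last-`m` coupling histories range in the compact
  cube `[0, τ]^ℕ` (Tychonoff), the fibre memory of everything older than `m` steps is `≤ θ'^m · 2δ`, so a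
  subsequence with convergent histories has Cauchy fibres (`E` complete).
* `norm_iterate_snd_le` / `exists_subseq_tendsto_orbit_of_basin` — the same from fibres anywhere in the basin
  `B̄_R` (e.g. the Wilson arc), after the transient `θ'^j R + Cτ²/(1 − θ')`.

Consequence (companion file `…WilsonAccumulation`): for odd `M`, from EVERY tuning sequence of Wilson orbit points
one extracts a subsequence along which all block-dilated genuine Wilson plaquette correlators converge jointly
(`Negative/OrbitTransport.tendsto_wilson_of_tendsto_orbit` supplies the values) — accumulation inside the chart,
and hence the continuum-type content of the continuity field (4c), cannot be designed away by the choice of `E`.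
-/

open Filter Topology
open Literature.MathematicalPhysics.QuantumFieldTheory

noncomputable section

namespace Summit.QuantumFields.YangMills.Theorems.BalabanStepParabolic

variable {G : Type} [Group G] [TopologicalSpace G] [IsTopologicalGroup G] [CompactSpace G]
  [MeasurableSpace G] [BorelSpace G] {r : LatticeRep G} {M : ℕ} (S : BalabanBanachStep G r M)

/-! ### One step along an orbit -/

/-- The fibre coordinate after one more step. [folklore] -/
theorem iterate_succ_snd (q : ℝ × S.E) (j : ℕ) :
    (S.F^[j + 1] q).2 = S.Ψ (S.F^[j] q).1 (S.F^[j] q).2 := by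
  rw [Function.iterate_succ_apply']; rfl

/-- The coupling after one more step. [folklore] -/
theorem iterate_succ_fst (q : ℝ × S.E) (j : ℕ) :
    (S.F^[j + 1] q).1 = S.φ (S.F^[j] q).1 (S.F^[j] q).2 := by
  rw [Function.iterate_succ_apply']; rfl

/-! ### Two-orbit synchronisation (fading fibre memory) -/

/-- **Two-orbit synchronisation.** Two orbit segments of length `m` with couplings in `[0, τ]`, `τ ≤ δ`, fibres
in `B̄_δ`, and couplings `η`-close step by step, end at fibre distance
`≤ θ'^m ‖q.2 − q'.2‖ + C (3δ) η m`. [folklore] -/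
theorem orbit_sync {τ η : ℝ} (hτ : τ ≤ S.δ) (hη : 0 ≤ η) (q q' : ℝ × S.E) (m : ℕ)
    (hq : ∀ j ≤ m, (S.F^[j] q).1 ∈ Set.Icc 0 τ ∧ ‖(S.F^[j] q).2‖ ≤ S.δ)
    (hq' : ∀ j ≤ m, (S.F^[j] q').1 ∈ Set.Icc 0 τ ∧ ‖(S.F^[j] q').2‖ ≤ S.δ)
    (hc : ∀ j < m, |(S.F^[j] q).1 - (S.F^[j] q').1| ≤ η) :
    ‖(S.F^[m] q).2 - (S.F^[m] q').2‖ ≤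
      S.θ' ^ m * ‖q.2 - q'.2‖ + S.C * (3 * S.δ) * η * m := by
  induction m with
  | zero => simp
  | succ m ih =>
    have ih' := ih (fun j hj => hq j (hj.trans (Nat.le_succ m)))
      (fun j hj => hq' j (hj.trans (Nat.le_succ m))) (fun j hj => hc j (hj.trans (Nat.lt_succ_self m)))
    obtain ⟨⟨hc0, hcτ⟩, hu⟩ := hq m (Nat.le_succ m)
    obtain ⟨⟨hc0', hcτ'⟩, hu'⟩ := hq' m (Nat.le_succ m)
    have hcm := hc m (Nat.lt_succ_self m)
    have hθ0 := S.θ'_nonneg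
    have hθ1 := S.θ'_lt_one.le
    have hC := S.C_pos.le
    have hδR := S.δ_le_R
    have habs : |(S.F^[m] q).1| ≤ S.δ := by rw [abs_of_nonneg hc0]; exact hcτ.trans hτ
    have habs' : |(S.F^[m] q').1| ≤ S.δ := by rw [abs_of_nonneg hc0']; exact hcτ'.trans hτ
    have h1 : ‖S.Ψ (S.F^[m] q).1 (S.F^[m] q).2 - S.Ψ (S.F^[m] q).1 (S.F^[m] q').2‖ ≤
        S.θ' * ‖(S.F^[m] q).2 - (S.F^[m] q').2‖ :=
      S.contraction _ _ _ habs (hu.trans hδR) (hu'.trans hδR)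
    have h2 : ‖S.Ψ (S.F^[m] q).1 (S.F^[m] q').2 - S.Ψ (S.F^[m] q').1 (S.F^[m] q').2‖ ≤
        S.C * (|(S.F^[m] q).1| + |(S.F^[m] q').1| + ‖(S.F^[m] q').2‖) *
          |(S.F^[m] q).1 - (S.F^[m] q').1| :=
      (S.lipschitz_base _ _ _ habs habs' hu').2
    have h3 : S.C * (|(S.F^[m] q).1| + |(S.F^[m] q').1| + ‖(S.F^[m] q').2‖) *
          |(S.F^[m] q).1 - (S.F^[m] q').1| ≤ S.C * (3 * S.δ) * η := by
      have hsum : |(S.F^[m] q).1| + |(S.F^[m] q').1| + ‖(S.F^[m] q').2‖ ≤ 3 * S.δ := by linarith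
      have habsd : 0 ≤ |(S.F^[m] q).1 - (S.F^[m] q').1| := abs_nonneg _
      have hCδ : 0 ≤ S.C * (3 * S.δ) := by have := S.δ_pos.le; positivity
      calc S.C * (|(S.F^[m] q).1| + |(S.F^[m] q').1| + ‖(S.F^[m] q').2‖) *
            |(S.F^[m] q).1 - (S.F^[m] q').1|
          ≤ S.C * (3 * S.δ) * |(S.F^[m] q).1 - (S.F^[m] q').1| :=
            mul_le_mul_of_nonneg_right (mul_le_mul_of_nonneg_left hsum hC) habsd
        _ ≤ S.C * (3 * S.δ) * η := mul_le_mul_of_nonneg_left hcm hCδ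
    rw [iterate_succ_snd, iterate_succ_snd]
    have hm0 : (0 : ℝ) ≤ m := Nat.cast_nonneg m
    have hΛ : 0 ≤ S.C * (3 * S.δ) * η := by
      have := S.δ_pos.le; positivity
    calc ‖S.Ψ (S.F^[m] q).1 (S.F^[m] q).2 - S.Ψ (S.F^[m] q').1 (S.F^[m] q').2‖
        ≤ ‖S.Ψ (S.F^[m] q).1 (S.F^[m] q).2 - S.Ψ (S.F^[m] q).1 (S.F^[m] q').2‖ +
            ‖S.Ψ (S.F^[m] q).1 (S.F^[m] q').2 - S.Ψ (S.F^[m] q').1 (S.F^[m] q').2‖ :=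
          norm_sub_le_norm_sub_add_norm_sub _ _ _
      _ ≤ S.θ' * ‖(S.F^[m] q).2 - (S.F^[m] q').2‖ + S.C * (3 * S.δ) * η := add_le_add h1 (h2.trans h3)
      _ ≤ S.θ' * (S.θ' ^ m * ‖q.2 - q'.2‖ + S.C * (3 * S.δ) * η * m) + S.C * (3 * S.δ) * η := by
          gcongr
      _ ≤ S.θ' ^ (m + 1) * ‖q.2 - q'.2‖ + S.C * (3 * S.δ) * η * (m + 1 : ℕ) := by
          have hx : S.θ' * (S.C * (3 * S.δ) * η * m) ≤ S.C * (3 * S.δ) * η * m := by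
            have : 0 ≤ S.C * (3 * S.δ) * η * m := mul_nonneg hΛ hm0
            nlinarith
          push_cast
          rw [pow_succ]
          nlinarith [norm_nonneg (q.2 - q'.2)]

/-! ### Precompactness of arrival states (chart-ball version) -/

/-- **Forced accumulation (chart-ball version).** Let `q i` be chart points whose orbit segments of lengths
`k i` keep every coupling in `[0, τ]` (`0 ≤ τ ≤ δ`) and every fibre in `B̄_δ`. If `k i → ∞`, the arrival points
`F^[k i] (q i)` have a subsequence converging in `ℝ × E` (to a point of `[0, τ] × B̄_δ`). The coupling histories
read backwards from arrival live in the compact metrisable cube `[0, τ]^ℕ`; along a subsequence with convergent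
histories the fibres are Cauchy by `orbit_sync` (memory older than `m` steps weighs `≤ θ'^m · 2δ`). [folklore] -/
theorem exists_subseq_tendsto_orbit {τ : ℝ} (hτ : τ ≤ S.δ)
    (q : ℕ → ℝ × S.E) (k : ℕ → ℕ)
    (hq : ∀ i, ∀ j ≤ k i, (S.F^[j] (q i)).1 ∈ Set.Icc 0 τ ∧ ‖(S.F^[j] (q i)).2‖ ≤ S.δ)
    (hk : Tendsto k atTop atTop) :
    ∃ ψ : ℕ → ℕ, StrictMono ψ ∧ ∃ p ∈ Set.Icc 0 τ ×ˢ Metric.closedBall (0 : S.E) S.δ,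
      Tendsto (fun i => S.F^[k (ψ i)] (q (ψ i))) atTop (𝓝 p) := by
  -- arrival points and backward coupling histories
  set P : ℕ → ℝ × S.E := fun i => S.F^[k i] (q i) with hP
  set hist : ℕ → ℝ × (ℕ → ℝ) := fun i => ((P i).1, fun j => (S.F^[k i - (j + 1)] (q i)).1) with hhist
  have hK : IsCompact (Set.Icc (0 : ℝ) τ ×ˢ Set.pi Set.univ fun _ : ℕ => Set.Icc (0 : ℝ) τ) :=
    isCompact_Icc.prod (isCompact_univ_pi fun _ => isCompact_Icc)
  have hmem : ∀ i, hist i ∈ Set.Icc (0 : ℝ) τ ×ˢ Set.pi Set.univ fun _ : ℕ => Set.Icc (0 : ℝ) τ := by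
    intro i
    refine Set.mk_mem_prod (hq i (k i) le_rfl).1 ?_
    intro j _
    exact (hq i (k i - (j + 1)) (Nat.sub_le _ _)).1
  obtain ⟨a, ha, ψ, hψ, hlim⟩ := hK.tendsto_subseq hmem
  have hfst : Tendsto (fun i => (P (ψ i)).1) atTop (𝓝 a.1) :=
    (continuous_fst.tendsto a).comp hlim
  have hcoord : ∀ j, Tendsto (fun i => (S.F^[k (ψ i) - (j + 1)] (q (ψ i))).1) atTop (𝓝 (a.2 j)) := by
    intro j
    have h2 : Tendsto (fun i => (hist (ψ i)).2) atTop (𝓝 a.2) := (continuous_snd.tendsto a).comp hlim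
    exact (tendsto_pi_nhds.1 h2) j
  have hkψ : Tendsto (fun i => k (ψ i)) atTop atTop := hk.comp hψ.tendsto_atTop
  have hθ0 := S.θ'_nonneg
  have hθ1 := S.θ'_lt_one
  have hδ := S.δ_pos
  have hC := S.C_pos
  -- the fibres are Cauchy
  have hCauchy : CauchySeq fun i => (P (ψ i)).2 := by
    rw [Metric.cauchySeq_iff]
    intro ε hε
    -- memory cut-off `m`
    obtain ⟨m, hm⟩ : ∃ m : ℕ, S.θ' ^ m < ε / (4 * S.δ + 4) :=
      exists_pow_lt_of_lt_one (by positivity) hθ1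
    have hm' : S.θ' ^ m * (2 * S.δ) ≤ ε / 2 := by
      have h1 : S.θ' ^ m * (2 * S.δ) ≤ ε / (4 * S.δ + 4) * (2 * S.δ) :=
        mul_le_mul_of_nonneg_right hm.le (by positivity)
      have h2 : ε / (4 * S.δ + 4) * (2 * S.δ) ≤ ε / 2 := by
        rw [div_mul_eq_mul_div, div_le_div_iff₀ (by positivity) (by positivity)]
        nlinarith
      exact h1.trans h2
    -- coupling tolerance `η`
    set Λ : ℝ := S.C * (3 * S.δ) with hΛ
    have hΛ0 : 0 < Λ := by positivity
    set η : ℝ := ε / (4 * (Λ * m + 1)) with hηdef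
    have hη : 0 < η := by positivity
    have hΛη : Λ * η * m ≤ ε / 4 := by
      have hm0 : (0 : ℝ) ≤ m := Nat.cast_nonneg m
      rw [hηdef]
      rw [show Λ * (ε / (4 * (Λ * ↑m + 1))) * ↑m = ε * (Λ * m) / (4 * (Λ * m + 1)) by ring]
      rw [div_le_div_iff₀ (by positivity) (by positivity)]
      nlinarith
    -- eventually: histories `η/2`-close to the limit on the first `m` coordinates, and `k ≥ m`
    have hev : ∀ᶠ i in atTop, m ≤ k (ψ i) ∧
        ∀ j ∈ Finset.range m, dist ((S.F^[k (ψ i) - (j + 1)] (q (ψ i))).1) (a.2 j) < η / 2 := by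
      refine (hkψ.eventually_ge_atTop m).and ?_
      rw [Filter.eventually_all_finset]
      intro j _
      exact (hcoord j).eventually (Metric.ball_mem_nhds _ (half_pos hη))
    obtain ⟨N, hN⟩ := eventually_atTop.1 hev
    refine ⟨N, fun i hi i' hi' => ?_⟩
    obtain ⟨hmi, hci⟩ := hN i hi
    obtain ⟨hmi', hci'⟩ := hN i' hi'
    -- the two arrival points are the ends of two synchronised segments of length `m`
    set Q : ℝ × S.E := S.F^[k (ψ i) - m] (q (ψ i)) with hQ
    set Q' : ℝ × S.E := S.F^[k (ψ i') - m] (q (ψ i')) with hQ'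
    have hPQ : P (ψ i) = S.F^[m] Q := by
      simp only [hP, hQ]
      rw [← Function.iterate_add_apply, Nat.add_sub_cancel' hmi]
    have hPQ' : P (ψ i') = S.F^[m] Q' := by
      simp only [hP, hQ']
      rw [← Function.iterate_add_apply, Nat.add_sub_cancel' hmi']
    have horbQ : ∀ j ≤ m, (S.F^[j] Q).1 ∈ Set.Icc 0 τ ∧ ‖(S.F^[j] Q).2‖ ≤ S.δ := by
      intro j hj
      have h := hq (ψ i) (j + (k (ψ i) - m)) (by omega)
      rwa [Function.iterate_add_apply] at h
    have horbQ' : ∀ j ≤ m, (S.F^[j] Q').1 ∈ Set.Icc 0 τ ∧ ‖(S.F^[j] Q').2‖ ≤ S.δ := by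
      intro j hj
      have h := hq (ψ i') (j + (k (ψ i') - m)) (by omega)
      rwa [Function.iterate_add_apply] at h
    have hclose : ∀ j < m, |(S.F^[j] Q).1 - (S.F^[j] Q').1| ≤ η := by
      intro j hj
      have hjm : m - 1 - j ∈ Finset.range m := Finset.mem_range.2 (by omega)
      have h1 := hci (m - 1 - j) hjm
      have h2 := hci' (m - 1 - j) hjm
      have e1 : S.F^[j] Q = S.F^[k (ψ i) - (m - 1 - j + 1)] (q (ψ i)) := by
        simp only [hQ]
        rw [← Function.iterate_add_apply]
        congr 1
        omega
      have e2 : S.F^[j] Q' = S.F^[k (ψ i') - (m - 1 - j + 1)] (q (ψ i')) := by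
        simp only [hQ']
        rw [← Function.iterate_add_apply]
        congr 1
        omega
      rw [e1, e2]
      rw [Real.dist_eq] at h1 h2
      calc |(S.F^[k (ψ i) - (m - 1 - j + 1)] (q (ψ i))).1 -
              (S.F^[k (ψ i') - (m - 1 - j + 1)] (q (ψ i'))).1|
          = |((S.F^[k (ψ i) - (m - 1 - j + 1)] (q (ψ i))).1 - a.2 (m - 1 - j)) -
              ((S.F^[k (ψ i') - (m - 1 - j + 1)] (q (ψ i'))).1 - a.2 (m - 1 - j))| := by ring_nf
        _ ≤ |(S.F^[k (ψ i) - (m - 1 - j + 1)] (q (ψ i))).1 - a.2 (m - 1 - j)| +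
              |(S.F^[k (ψ i') - (m - 1 - j + 1)] (q (ψ i'))).1 - a.2 (m - 1 - j)| := abs_sub _ _
        _ ≤ η := by linarith
    have hsync := orbit_sync S hτ hη.le Q Q' m horbQ horbQ' hclose
    have hQ2 : ‖Q.2 - Q'.2‖ ≤ 2 * S.δ := by
      have h1 := (horbQ 0 (Nat.zero_le m)).2
      have h2 := (horbQ' 0 (Nat.zero_le m)).2
      simp only [Function.iterate_zero, id_eq] at h1 h2
      calc ‖Q.2 - Q'.2‖ ≤ ‖Q.2‖ + ‖Q'.2‖ := norm_sub_le _ _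
        _ ≤ 2 * S.δ := by linarith
    rw [dist_eq_norm, hPQ, hPQ']
    calc ‖(S.F^[m] Q).2 - (S.F^[m] Q').2‖
        ≤ S.θ' ^ m * ‖Q.2 - Q'.2‖ + S.C * (3 * S.δ) * η * m := hsync
      _ ≤ S.θ' ^ m * (2 * S.δ) + Λ * η * m := by rw [hΛ]; gcongr
      _ ≤ ε / 2 + ε / 4 := add_le_add hm' hΛη
      _ < ε := by linarith
  obtain ⟨y, hy⟩ := cauchySeq_tendsto_of_complete hCauchy
  have hymem : y ∈ Metric.closedBall (0 : S.E) S.δ := by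
    refine Metric.isClosed_closedBall.mem_of_tendsto hy (Eventually.of_forall fun i => ?_)
    rw [Metric.mem_closedBall, dist_zero_right]
    exact (hq (ψ i) (k (ψ i)) le_rfl).2
  refine ⟨ψ, hψ, (a.1, y), Set.mk_mem_prod ha.1 hymem, ?_⟩
  have h := hfst.prodMk_nhds hy
  simpa only [hP, Prod.mk.eta] using h

/-! ### From the basin: the transient -/

/-- **Fibre decay along an orbit segment with small couplings**: if the couplings of the first `n` steps lie
in `[0, τ]`, `τ ≤ δ`, `C τ² ≤ (1 − θ') R`, and the orbit starts in the basin `B̄_R`, then the fibre stays in the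
basin and `‖(F^[n] q).2‖ ≤ θ'^n ‖q.2‖ + C τ² / (1 − θ')`. [folklore] -/
theorem norm_iterate_snd_le {τ : ℝ} (hτ : τ ≤ S.δ) (hsmall : S.C * τ ^ 2 ≤ (1 - S.θ') * S.R)
    (q : ℝ × S.E) (hq2 : ‖q.2‖ ≤ S.R) (n : ℕ)
    (hq : ∀ j < n, (S.F^[j] q).1 ∈ Set.Icc 0 τ) :
    ‖(S.F^[n] q).2‖ ≤ S.R ∧
      ‖(S.F^[n] q).2‖ ≤ S.θ' ^ n * ‖q.2‖ + S.C * τ ^ 2 / (1 - S.θ') := by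
  have hθ0 := S.θ'_nonneg
  have hθ1 := S.θ'_lt_one
  have hC := S.C_pos.le
  have h1θ : 0 < 1 - S.θ' := by linarith
  induction n with
  | zero =>
    refine ⟨by simpa using hq2, ?_⟩
    simp only [Function.iterate_zero, id_eq, pow_zero, one_mul, le_add_iff_nonneg_right]
    positivity
  | succ n ih =>
    obtain ⟨ihR, ihd⟩ := ih fun j hj => hq j (hj.trans (Nat.lt_succ_self n))
    obtain ⟨hc0, hcτ⟩ := hq n (Nat.lt_succ_self n)
    have habs : |(S.F^[n] q).1| ≤ S.δ := by rw [abs_of_nonneg hc0]; exact hcτ.trans hτ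
    have hsq : (S.F^[n] q).1 ^ 2 ≤ τ ^ 2 := pow_le_pow_left₀ hc0 hcτ 2
    have hstep := S.norm_Ψ_le habs ihR
    have hsmall' : S.C * (S.F^[n] q).1 ^ 2 ≤ (1 - S.θ') * S.R :=
      (mul_le_mul_of_nonneg_left hsq hC).trans hsmall
    rw [iterate_succ_snd]
    refine ⟨S.norm_Ψ_le_R habs ihR hsmall', ?_⟩
    calc ‖S.Ψ (S.F^[n] q).1 (S.F^[n] q).2‖
        ≤ S.θ' * ‖(S.F^[n] q).2‖ + S.C * (S.F^[n] q).1 ^ 2 := hstep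
      _ ≤ S.θ' * (S.θ' ^ n * ‖q.2‖ + S.C * τ ^ 2 / (1 - S.θ')) + S.C * τ ^ 2 := by gcongr
      _ = S.θ' ^ (n + 1) * ‖q.2‖ + S.C * τ ^ 2 / (1 - S.θ') := by
          rw [pow_succ]
          field_simp
          ring

/-- **Forced accumulation (basin version).** Let `q i` be points with fibres in the basin `B̄_R` whose orbit
segments of lengths `k i → ∞` keep every coupling in `[0, τ]`, where `0 ≤ τ ≤ δ` and `C τ² ≤ (1 − θ') δ / 2`.
Then the arrival points `F^[k i] (q i)` have a subsequence converging in `ℝ × E` to a point of the chart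
`[0, τ] × B̄_δ`: after a transient of `j₀` steps (`θ'^{j₀} R ≤ δ/2`) every fibre is inside `B̄_δ`
(`norm_iterate_snd_le`), and `exists_subseq_tendsto_orbit` applies to the shifted segments. [folklore] -/
theorem exists_subseq_tendsto_orbit_of_basin {τ : ℝ} (hτ : τ ≤ S.δ)
    (hsmall : S.C * τ ^ 2 ≤ (1 - S.θ') * (S.δ / 2))
    (q : ℕ → ℝ × S.E) (k : ℕ → ℕ) (hq2 : ∀ i, ‖(q i).2‖ ≤ S.R)
    (hq : ∀ i, ∀ j ≤ k i, (S.F^[j] (q i)).1 ∈ Set.Icc 0 τ)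
    (hk : Tendsto k atTop atTop) :
    ∃ ψ : ℕ → ℕ, StrictMono ψ ∧ ∃ p ∈ Set.Icc 0 τ ×ˢ Metric.closedBall (0 : S.E) S.δ,
      Tendsto (fun i => S.F^[k (ψ i)] (q (ψ i))) atTop (𝓝 p) := by
  have hθ0 := S.θ'_nonneg
  have hθ1 := S.θ'_lt_one
  have hδ := S.δ_pos
  have hR := S.R_pos
  have hC := S.C_pos.le
  have h1θ : 0 < 1 - S.θ' := by linarith
  have hsmallR : S.C * τ ^ 2 ≤ (1 - S.θ') * S.R := by
    have := S.δ_le_R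
    nlinarith
  have htail : S.C * τ ^ 2 / (1 - S.θ') ≤ S.δ / 2 := by
    rw [div_le_iff₀ h1θ]; linarith
  -- transient length `j₀`
  obtain ⟨j₀, hj₀⟩ : ∃ j₀ : ℕ, S.θ' ^ j₀ < S.δ / (2 * S.R) := exists_pow_lt_of_lt_one (by positivity) hθ1
  have hj₀' : ∀ n, j₀ ≤ n → S.θ' ^ n * S.R ≤ S.δ / 2 := by
    intro n hn
    have h1 : S.θ' ^ n ≤ S.θ' ^ j₀ := pow_le_pow_of_le_one hθ0 hθ1.le hn
    have h2 : S.θ' ^ j₀ * S.R ≤ S.δ / (2 * S.R) * S.R := mul_le_mul_of_nonneg_right hj₀.le hR.le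
    have h3 : S.δ / (2 * S.R) * S.R = S.δ / 2 := by field_simp
    nlinarith
  -- fibres are inside `B̄_δ` from step `j₀` on
  have hin : ∀ i, ∀ n, j₀ ≤ n → n ≤ k i → ‖(S.F^[n] (q i)).2‖ ≤ S.δ := by
    intro i n hn hnk
    have h := (norm_iterate_snd_le S hτ hsmallR (q i) (hq2 i) n
      (fun j hj => hq i j (hj.le.trans hnk))).2
    have hq2i := hq2 i
    calc ‖(S.F^[n] (q i)).2‖ ≤ S.θ' ^ n * ‖(q i).2‖ + S.C * τ ^ 2 / (1 - S.θ') := h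
      _ ≤ S.θ' ^ n * S.R + S.δ / 2 := by gcongr
      _ ≤ S.δ / 2 + S.δ / 2 := by linarith [hj₀' n hn]
      _ = S.δ := by ring
  -- shift to the tail where `k ≥ j₀`
  obtain ⟨i₀, hi₀⟩ := eventually_atTop.1 (hk.eventually_ge_atTop j₀)
  set q' : ℕ → ℝ × S.E := fun i => S.F^[j₀] (q (i + i₀)) with hq'def
  set k' : ℕ → ℕ := fun i => k (i + i₀) - j₀ with hk'def
  have hk' : Tendsto k' atTop atTop := by
    have h1 : Tendsto (fun i => k (i + i₀)) atTop atTop := hk.comp (tendsto_add_atTop_nat i₀)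
    exact (tendsto_atTop_atTop.2 fun b => by
      obtain ⟨N, hN⟩ := tendsto_atTop_atTop.1 h1 (b + j₀)
      exact ⟨N, fun n hn => by have := hN n hn; simp only [hk'def]; omega⟩)
  have hq' : ∀ i, ∀ j ≤ k' i, (S.F^[j] (q' i)).1 ∈ Set.Icc 0 τ ∧ ‖(S.F^[j] (q' i)).2‖ ≤ S.δ := by
    intro i j hj
    have hki : j₀ ≤ k (i + i₀) := hi₀ (i + i₀) (Nat.le_add_left i₀ i)
    have hjk : j + j₀ ≤ k (i + i₀) := by simp only [hk'def] at hj; omega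
    have e : S.F^[j] (q' i) = S.F^[j + j₀] (q (i + i₀)) := by
      simp only [hq'def]; rw [Function.iterate_add_apply]
    rw [e]
    exact ⟨hq (i + i₀) (j + j₀) hjk, hin (i + i₀) (j + j₀) (Nat.le_add_left j₀ j) hjk⟩
  obtain ⟨ψ', hψ', p, hp, hlim⟩ := exists_subseq_tendsto_orbit S hτ q' k' hq' hk'
  refine ⟨fun i => ψ' i + i₀, fun a b hab => Nat.add_lt_add_right (hψ' hab) i₀, p, hp, ?_⟩
  refine hlim.congr fun i => ?_
  have hki : j₀ ≤ k (ψ' i + i₀) := hi₀ _ (Nat.le_add_left i₀ _)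
  simp only [hq'def, hk'def]
  rw [← Function.iterate_add_apply, Nat.sub_add_cancel hki]

/-- **Forced accumulation** (registered sub-goal `orbit_precompact` of the crux item; all binders explicit):
for every inhabitant `S` of `BalabanBanachStep G r M`, every threshold `τ ≤ δ` with `C τ² ≤ (1 − θ') δ / 2`,
and every family of basin points whose orbit segments of lengths `k i → ∞` keep their couplings in `[0, τ]`, the
arrival points have a subsequence converging in the chart. [folklore] -/
theorem orbit_precompact :
    ∀ (G : Type) [Group G] [TopologicalSpace G] [IsTopologicalGroup G] [CompactSpace G]
      [MeasurableSpace G] [BorelSpace G]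
      (r : Literature.MathematicalPhysics.QuantumFieldTheory.LatticeRep G) (M : ℕ)
      (S : Literature.MathematicalPhysics.QuantumFieldTheory.BalabanBanachStep G r M) (τ : ℝ),
      τ ≤ S.δ → S.C * τ ^ 2 ≤ (1 - S.θ') * (S.δ / 2) →
      ∀ (q : ℕ → ℝ × S.E) (k : ℕ → ℕ), (∀ i, ‖(q i).2‖ ≤ S.R) →
        (∀ i, ∀ j ≤ k i, (S.F^[j] (q i)).1 ∈ Set.Icc 0 τ) →
        Filter.Tendsto k Filter.atTop Filter.atTop →
        ∃ ψ : ℕ → ℕ, StrictMono ψ ∧ ∃ p ∈ Set.Icc 0 τ ×ˢ Metric.closedBall (0 : S.E) S.δ,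
          Filter.Tendsto (fun i => S.F^[k (ψ i)] (q (ψ i))) Filter.atTop (nhds p) :=
  fun _G _ _ _ _ _ _ _r _M S _τ hτ hsmall q k hq2 hq hk =>
    exists_subseq_tendsto_orbit_of_basin S hτ hsmall q k hq2 hq hk

end Summit.QuantumFields.YangMills.Theorems.BalabanStepParabolic

end
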